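import Summits.ABC.StewartYu.PadicG3ParVH
import Summits.ABC.StewartYu.PadicG3ExitCPrep
import HarnessLib

/-!
# The `p`-adic Gen-3 parameter record v2 (corrected family `…V`) — part VI: the excess gain is a small power of `p`

Support file (plain theorems; no named facts). Continues `PadicG3ParVH`. Headline blocks for the m = 0 branch:
* `g ≤ log p/(4(n+1))` at `m = 0` (`G = θ₀ log p`, `θ₀ ≤ 2`), hence **`n·log g ≤ log p/4`** and **`gⁿ ≤ exp(log p/4) = p^{1/4}`**
  (`log g ≤ g − 1 < g`);
* **`RLgV ≤ 2^{n+25} + 2Amax + 4ŜG + 11`** and **`ŜG ≤ n + 26 + (log N_q + log g)/log 2`** (`2^{lgg} < 4g`,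
  `⌊log₂ N_q⌋·log 2 ≤ log N_q`): the residual branches of `LgV` are logarithmic in `p`, `N_q` and linear in `Amax`.

## References
* [Yu2013] K. Yu, Acta Math. 211 (2013) — Theorem 1 (shape of the main term).
-/

noncomputable section

open Finset Real

namespace Summit.ABC.StewartYu

namespace PadicG3Par

variable {n : ℕ} (P : PadicG3Par n)

/-- at `m = 0`: `g ≤ log p/(4(n+1))` (as `G = θ₀ log p`, `θ₀ ≤ 2`). [folklore] -/
theorem g_le_log_div (hm : P.m = 0) : P.g ≤ Real.log P.p / (4 * (n + 1)) := by
  have hG : P.G = P.θ₀ * Real.log P.p := by unfold G θm; rw [hm]; push_cast; ring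
  have hθ := P.hθ₀2
  have hl := P.log_p_pos
  unfold g cG
  rw [hG, div_le_div_iff₀ (by positivity) (by positivity)]
  have hθlog : P.θ₀ * Real.log P.p ≤ 2 * Real.log P.p := by nlinarith
  have hn0 : (0 : ℝ) ≤ (n : ℝ) + 1 := by positivity
  nlinarith [mul_le_mul_of_nonneg_right hθlog hn0]

/-- at `m = 0`: **`n · log g ≤ log p/4`** (`log g < g ≤ log p/(4(n+1))`). [folklore] -/
theorem n_mul_log_g_le (hm : P.m = 0) : (n : ℝ) * Real.log P.g ≤ Real.log P.p / 4 := by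
  have hg1 := P.one_le_g
  have hg := P.g_le_log_div hm
  have hl := P.log_p_pos
  have hlog : Real.log P.g ≤ P.g := by
    have := Real.log_le_sub_one_of_pos (lt_of_lt_of_le one_pos hg1); linarith
  have hn0 : (0 : ℝ) ≤ n := by positivity
  have h1 : (n : ℝ) * Real.log P.g ≤ n * P.g := mul_le_mul_of_nonneg_left hlog hn0
  have h2 : (n : ℝ) * P.g ≤ n * (Real.log P.p / (4 * (n + 1))) := mul_le_mul_of_nonneg_left hg hn0
  have h3 : (n : ℝ) * (Real.log P.p / (4 * (n + 1))) ≤ Real.log P.p / 4 := by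
    rw [mul_div_assoc', div_le_div_iff₀ (by positivity) (by norm_num)]
    nlinarith
  linarith

/-- at `m = 0`: **`gⁿ ≤ exp(log p/4)`** (`= p^{1/4}`). [folklore] -/
theorem g_pow_le_exp (hm : P.m = 0) : P.g ^ n ≤ Real.exp (Real.log P.p / 4) := by
  have hg0 : 0 < P.g := lt_of_lt_of_le one_pos P.one_le_g
  have h := P.n_mul_log_g_le hm
  calc P.g ^ n = Real.exp (n * Real.log P.g) := by rw [← Real.log_pow, Real.exp_log (pow_pos hg0 n)]
    _ ≤ Real.exp (Real.log P.p / 4) := Real.exp_le_exp.mpr h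

/-- `exp(log p/4)^4 = p` (so `gⁿ ≤ p^{1/4}`). [folklore] -/
theorem exp_log_div_four_pow : Real.exp (Real.log P.p / 4) ^ 4 = P.p := by
  rw [← Real.exp_nat_mul]
  have hp : (0 : ℝ) < P.p := by linarith [P.two_le_p]
  rw [show ((4 : ℕ) : ℝ) * (Real.log P.p / 4) = Real.log P.p by push_cast; ring]
  exact Real.exp_log hp

/-- **`RLgV ≤ 2^{n+25} + 2 Amax + 4 ŜG + 11`** (`g ≥ 1`). [folklore] -/
theorem RLgV_le : P.RLgV ≤ 2 ^ (n + 25) + 2 * P.Amax + 4 * P.SdG + 11 := by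
  unfold RLgV
  have hg := P.one_le_g
  have hA0 : 0 ≤ P.Amax := le_trans (P.A_pos ⟨0, by have := P.hn; omega⟩).le (P.hAmax _)
  have h1 : (2 * P.Amax + 1) / P.g ≤ 2 * P.Amax + 1 := div_le_self (by linarith) hg
  linarith

/-- `lgg · log 2 < log 4 + log g` (from `2^{lgg} < 4g`). [folklore] -/
theorem lgg_log_two_lt : (P.lgg : ℝ) * Real.log 2 < Real.log 4 + Real.log P.g := by
  have h := P.two_pow_lgg_lt
  have hg0 : 0 < P.g := lt_of_lt_of_le one_pos P.one_le_g
  have h1 := Real.log_lt_log (by positivity) h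
  rw [Real.log_pow, Real.log_mul (by norm_num) hg0.ne'] at h1
  exact h1

/-- **`ŜG ≤ n + 26 + (log N_q + log g)/log 2`**. [folklore] -/
theorem SdG_le_real : (P.SdG : ℝ) ≤ n + 26 + (Real.log P.Nq + Real.log P.g) / Real.log 2 := by
  have h1 := P.natlog_mul_log_two_le
  have h2 := P.lgg_log_two_lt
  have hl2 : 0 < Real.log 2 := Real.log_pos (by norm_num)
  have hl4 : Real.log 4 = 2 * Real.log 2 := by
    rw [show (4 : ℝ) = 2 ^ 2 by norm_num, Real.log_pow]; push_cast; ring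
  unfold SdG; push_cast
  have h3 : ((Nat.log 2 P.Nq : ℝ) + P.lgg) * Real.log 2 ≤ Real.log P.Nq + Real.log P.g + 2 * Real.log 2 := by
    nlinarith
  have h4 : (Nat.log 2 P.Nq : ℝ) + P.lgg ≤ (Real.log P.Nq + Real.log P.g) / Real.log 2 + 2 := by
    rw [div_add' _ _ _ hl2.ne', le_div_iff₀ hl2]; linarith
  linarith

end PadicG3Par

end Summit.ABC.StewartYu
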